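import Summits.BirchSwinnertonDyer.BirchSwinnertonDyer.Theorems.KatoDescentPotSupersingularMemberHullZetaInputsOfCore
import Summits.BirchSwinnertonDyer.BirchSwinnertonDyer.Theorems.KatoDescentPotSupersingularMemberHullZetaCoreInputsOfKummer
import Summits.BirchSwinnertonDyer.BirchSwinnertonDyer.Theorems.KatoDescentPotSupersingularReducibleKatoMemberZetaInputsDescent
import Summits.BirchSwinnertonDyer.BirchSwinnertonDyer.Theorems.KatoDescentPotSupersingularKatoSelmerPTCokernelTorsion
import Summits.BirchSwinnertonDyer.BirchSwinnertonDyer.Theorems.KatoDescentPotSupersingularPadicPointsApproximation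
import Summits.BirchSwinnertonDyer.BirchSwinnertonDyer.Theorems.PoitouTateSelmerStructureDualityConjHolds
import Summits.BirchSwinnertonDyer.Rank1Residual.X11b.KummerLocalIndex
import Summits.BirchSwinnertonDyer.Rank1Residual.X11b.KummerPoitouTateExact
import Literature.NumberTheory.EllipticCurves.Rank1Residual.Typed.X5DescentSelmer
import Literature.NumberTheory.EllipticCurves.MordellWeilRankZeroProofs
import HarnessLib

/-!
# Kato's rank statement WITHOUT Gross–Zagier–Kolyvagin: a class `y₀ ∈ H¹(ℤ[1/p], T_pW)` whose zeta line has a local index at `p`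
# (`Kato2004.ZetaLineOrthIndexAt W p y₀ e`, clause (b′) of crux M's held CORE package) forces `W(ℚ)` to be FINITE;
# hence `exists_memberHullZetaCoreInputs → exists_memberHullZetaInputs` and the O6 node of crux M from {modularity, core package} ALONE
# (route `KatoDescentPotSupersingular` / `…Tame…`, crux M = stmt-BirchSwinnertonDyer-19196 `ReducibleKatoMember`; route-free helper)

Seat `bsd-potss-rkm` g25 (prover; cell `bsd-potss`), item stmt-BirchSwinnertonDyer-19196 (`--supports … --as helper`; closes nothing).
HONEST FRAMING: BSD is not proved by any of this; nothing is booked; theorems only (no definition, no named fact).  The held input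
`Kato2004.exists_memberHullZetaCoreInputs` (item 27962; Kato's Euler system and explicit reciprocity at the member, size XL) is UNCHANGED;
what changes is the derivation: Gross–Zagier–Kolyvagin (`rank_eq_analyticRank_of_analyticRank_le_one`, KT child 20298 / the GZK half of
K9's bundle 28002) is NOT needed to pass from the core package to crux M — as in print, where Kato obtains the finiteness of `E(ℚ)` for
`L(E,1) ≠ 0` from his own Euler system (Astérisque 295, Cor. 14.3 / Thm. 14.5), not from Heegner points.

## The argument (Kato Thm. 14.5 / Cor. 14.3, finite-level form)

Let `y₀ ∈ A = H¹(ℤ[1/p], T_pW)` satisfy `ZetaLineOrthIndexAt W p y₀ e`: for all large levels `p^k`, every `j`, every Poitou–Tate family and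
Weil datum, and every integer `c`, IF `f_k(c·y₀) = loc_p (desc^♭)_* ι′_* red_{p^k}(c·y₀)` is orthogonal to the local Kummer condition
`𝓚_{k,p}` THEN `p^k ∣ c·p^e`.  Suppose `P ∈ W(ℚ)` has infinite order.
1. (§1, RECIPROCITY) `⟨loc_p κ_k(Q), f_k(c)⟩_p = 0` for every rational point `Q`, every integral `c`: the global Kummer class `κ_k(Q)` and the
   global class `(desc^♭)_* ι′_* red_{p^k}(c)` have vanishing local terms at `∞` (odd level), at every `ℓ ≠ p` (`loc_ℓ κ_k(Q)` is Kummer,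
   i.e. dies in `H¹(ℚ_ℓ, W[p^∞])` — the tree's torsion saturation `kummerLocalConditionAt_eq_ker_map_primaryInclusion` — and seat g24's
   `localTatePairingZMod_map_descend_reduceH1Pk_eq_zero`: tower + adjointness + Milne I 2.6), so Poitou–Tate reciprocity
   (`SumLocalTermEqZero`, a theorem over `ℚ`) kills the term at `p`.
2. (`…PadicPointsApproximation`, THE LOG LATTICE) there is ONE integer `M ≠ 0` with `M·x ∈ ℤ·P + p^k W(ℚ_p)` for every `k`, `x ∈ W(ℚ_p)`.
3. Hence `f_k(M·y₀) = M·f_k(y₀)` is orthogonal to ALL of `𝓚_{k,p} = κ(W(ℚ_p))`: `⟨κ(x), M f⟩ = ⟨κ(Mx), f⟩ = ⟨κ(nP), f⟩ = n⟨loc_p κ_k(P), f⟩ = 0`.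
   The predicate gives `p^k ∣ M·p^e` for every large `k` — absurd.  So `W(ℚ)` is torsion, hence finite (Mordell–Weil, tree theorem).

## What

* `localTatePairingZMod_localization_kummerMapTorsion_descend_reduceH1Pk_eq_zero` (§1) — the orthogonality of step 1.
* **`finite_point_of_zetaLineOrthIndexAt`** (§2) — `ZetaLineOrthIndexAt W p y₀ e`, `y₀` integral, `p` odd, Poitou–Tate ⟹ `Finite W(ℚ)`.
* `MemberHullZetaCoreInputs.finite_point_of_PT` (§3) — on a core package `W(ℚ)` is finite; **`exists_memberHullZetaInputs_of_coreInputs_noGZK :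
  exists_memberHullZetaCoreInputs → exists_memberHullZetaInputs`** (Poitou–Tate discharged, NO GZK); `…_of_kummerCoreInputs_noGZK`;
  **`katoMemberShaBoundOfReducible_of_newform_of_coreInputs : exists_isNewformOf → exists_memberHullZetaCoreInputs →
  O6.KatoMemberShaBoundOfReducible`** and its Kummer-form twin — crux M's node from {modularity, core package} alone.

References: K. Kato, Astérisque 295 (2004), Thm. 14.2, Cor. 14.3, Thm. 14.5 (pp. 235–236), Prop. 14.16 (2) and its proof (pp. 244–245),
Lemma 14.18 (pp. 247–248) [Kato2004Asterisque]; J. S. Milne, *ADT* I Cor. 2.3, Thm. 2.6, Thm. 4.10 (b), I §6 Lemma 6.15 [MilneADT2006];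
J. H. Silverman, *AEC* VII.6.3, VIII.6.7, X.§4 [SilvermanAEC2009].
-/

-- the summit and its single problem are both named `BirchSwinnertonDyer` (registry layout D-0017)
set_option linter.dupNamespace false
set_option autoImplicit false

noncomputable section

open scoped Classical ContRepresentation NumberField TensorProduct
open CategoryTheory Function Field NumberField IsDedekindDomain WeierstrassCurve CongruenceSubgroup
open Literature.NumberTheory.EllipticCurves Literature.NumberTheory.GaloisRepresentations
  Literature.NumberTheory.GaloisRepresentations.DiscreteGaloisModule Literature.NumberTheory.GaloisCohomology
open Literature.NumberTheory.EllipticCurves.ModularForms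
open Literature.NumberTheory.EllipticCurves.Kato2004 Literature.NumberTheory.EllipticCurves.Kato2004.EulerSystemValues
open Literature.NumberTheory.EllipticCurves.IwasawaAlgebra Rat.HeightOneSpectrum
open Summit.BirchSwinnertonDyer.Rank1Residual.X11b.Levels Summit.BirchSwinnertonDyer.Rank1Residual.X11b.LocBridge
  Summit.BirchSwinnertonDyer.Rank1Residual.X11b.LevelKummer Summit.BirchSwinnertonDyer.Rank1Residual.X11b.AcSelmer
open Summit.BirchSwinnertonDyer.Rank1Residual.GaloisImage
open Summit.BirchSwinnertonDyer.BirchSwinnertonDyer.Theorems.KummerTowerOrthogonal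
open Summit.BirchSwinnertonDyer.BirchSwinnertonDyer.Rank1Residual
open Summit.BirchSwinnertonDyer.BirchSwinnertonDyer.Theorems
open Summit.BirchSwinnertonDyer.BirchSwinnertonDyer.Theorems.KatoFiniteLevelCount
open Summit.BirchSwinnertonDyer.BirchSwinnertonDyer.Theorems.MemberHullZetaInputsOfCore

namespace Summit.BirchSwinnertonDyer.BirchSwinnertonDyer.Theorems.ZetaLineRankZero

/-! ## §1 Reciprocity: Kummer classes of rational points are orthogonal at `p` to the reductions of integral classes -/

section Orthogonal

variable (W : WeierstrassCurve ℚ) [W.IsElliptic] (p j k : ℕ) [hp : Fact p.Prime] [ContinuousSMul ℤ_[p] (W.tateModule p)]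
  (e : geomTorsion W ((p ^ j * p ^ k : ℕ) : ℤ) → geomTorsion W ((p ^ j * p ^ k : ℕ) : ℤ) → AlgebraicClosure ℚ)
  (hμ : ∀ S T, e S T ^ (p ^ j * p ^ k) = 1)
  (hadd₁ : ∀ S₁ S₂ T, e (S₁ + S₂) T = e S₁ T * e S₂ T)
  (hadd₂ : ∀ S T₁ T₂, e S (T₁ + T₂) = e S T₁ * e S T₂)
  (hgal : ∀ (σ : absoluteGaloisGroup ℚ) (S T : geomTorsion W ((p ^ j * p ^ k : ℕ) : ℤ)), σ • e S T = e (σ • S) (σ • T))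
  (inv : LocalInvariants ℚ (p ^ j * p ^ k))
  [Finite (geomTorsion W ((p ^ j * p ^ k : ℕ) : ℤ))] [Finite (geomTorsion W ((p ^ k : ℕ) : ℤ))]

/-- **`⟨loc_p κ_k(Q), loc_p (desc^♭)_* ι′_* red_{p^k}(c)⟩_p = 0`** for a rational point `Q ∈ W(ℚ)`, an integral class
`c ∈ A = H¹(ℤ[1/p], T_pW)`, an odd `p`, a family `inv` with the Poitou–Tate vanishing, and (hN) off `p` for `(k, j)`: the local terms of the
two GLOBAL classes vanish at `∞` (odd level), and at `ℓ ≠ p` because `loc_ℓ κ_k(Q)` is a local Kummer class, which dies in `H¹(ℚ_ℓ, W[p^∞])`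
(torsion saturation at `ℓ ∤ p`), against the reduction of an integral class (seat g24, tower + adjointness + Milne I 2.6); reciprocity
finishes. [cite: MilneADT2006, Ch. I, Thm. 4.10 (b), Thm. 2.6] [cite: Kato2004Asterisque, proof of Prop. 14.16 (pp. 244–245)]
[cite: SilvermanAEC2009, X.§4 diagram (**)] -/
theorem localTatePairingZMod_localization_kummerMapTorsion_descend_reduceH1Pk_eq_zero (hodd : p ≠ 2)
    (hsum : inv.SumLocalTermEqZero)
    (hN : ∀ v : HeightOneSpectrum (𝓞 ℚ), v ≠ primePlace p → ∀ x : W.geomPrimaryTorsion p,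
      (∀ τ ∈ absInertia (v.adicCompletion ℚ), GaloisRep.toLocal v (primaryGaloisModule W p) τ x = x) →
        ∃ d : W.geomPrimaryTorsion p,
          (∀ τ ∈ absInertia (v.adicCompletion ℚ), GaloisRep.toLocal v (primaryGaloisModule W p) τ d = d) ∧
            p ^ (k + j) • d = p ^ j • x)
    {c : H1 (tateRep W p) ⊤} (hc : c ∈ integralH1 (tateRep W p) p ⊤)
    (hdiv : ∀ P : geomPoints W, ∃ Q : geomPoints W, ((p ^ k : ℕ) : ℤ) • Q = P) (Q : W.toAffine.Point) :
    localTatePairingZMod (W.torsionGaloisModule ((p ^ k : ℕ) : ℤ)) (p ^ j * p ^ k) (Sum.inr (primePlace p))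
        (inv (Sum.inr (primePlace p)))
        (galoisCohomology.localization (W.torsionGaloisModule ((p ^ k : ℕ) : ℤ)) (Sum.inr (primePlace p)) 1
          (kummerMapTorsion W ((p ^ k : ℕ) : ℤ) hdiv Q))
        (galoisCohomology.localization ((W.torsionGaloisModule ((p ^ k : ℕ) : ℤ)).tateDual (p ^ j * p ^ k))
            (Sum.inr (primePlace p)) 1
          (galoisCohomology.map (pairingDualIntertwining
              (ρ₁ := W.torsionGaloisModule ((p ^ k : ℕ) : ℤ)) (ρ₂ := W.torsionGaloisModule ((p ^ k : ℕ) : ℤ))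
              (B := descendHom W (p ^ j) (p ^ k) e hμ hadd₁ hadd₂)
              (descendHom_smul W (p ^ j) (p ^ k) e hμ hadd₁ hadd₂ hgal)) 1
            (galoisCohomology.map (W.torsionInclusion (intPow_dvd_natCast_pow p k)) 1
              ((ofTopSubgroup (W.torsionGaloisModule ((p : ℤ) ^ k)).toTopRep 1).hom (reduceH1Pk W p k ⊤ c))))) = 0 := by
  have hpp : p.Prime := hp.out
  haveI := neZero_pow p j; haveI := neZero_pow p k
  set ρ := W.torsionGaloisModule ((p ^ k : ℕ) : ℤ) with hρ
  have hM : ∀ m : geomTorsion W ((p ^ k : ℕ) : ℤ), (p ^ j * p ^ k) • m = 0 := fun m => by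
    rw [mul_smul, pow_nsmul_geomTorsion_eq_zero, smul_zero]
  have hodd' : Odd (p ^ j * p ^ k) := (hpp.odd_of_ne_two hodd).pow.mul (hpp.odd_of_ne_two hodd).pow
  have hn : ((p ^ k : ℕ) : ℤ) ≠ 0 := Int.natCast_ne_zero.mpr (NeZero.ne (p ^ k))
  set x := kummerMapTorsion W ((p ^ k : ℕ) : ℤ) hdiv Q with hx
  set z := galoisCohomology.map (W.torsionInclusion (intPow_dvd_natCast_pow p k)) 1
    ((ofTopSubgroup (W.torsionGaloisModule ((p : ℤ) ^ k)).toTopRep 1).hom (reduceH1Pk W p k ⊤ c)) with hz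
  set B := pairingDualIntertwining (ρ₁ := ρ) (ρ₂ := ρ) (B := descendHom W (p ^ j) (p ^ k) e hμ hadd₁ hadd₂)
    (descendHom_smul W (p ^ j) (p ^ k) e hμ hadd₁ hadd₂ hgal) with hB
  have h := hsum.localTerm_eq_zero ρ hM x (galoisCohomology.map B 1 z) (Sum.inr (primePlace p)) (fun v hv => ?_)
  · rw [LocalInvariants.localTerm_apply, ← DiscreteGaloisModule.localTatePairingZMod_apply] at h
    exact h
  rcases v with w | ℓ
  · exact StepFour.localTerm_inl_eq_zero_of_odd inv ρ hodd' hM w x _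
  · have hℓ : ℓ ≠ primePlace p := fun h' => hv (by rw [h'])
    rw [LocalInvariants.localTerm_apply, ← DiscreteGaloisModule.localTatePairingZMod_apply, localization_map_one']
    refine localTatePairingZMod_map_descend_reduceH1Pk_eq_zero W p j k e hμ hadd₁ hadd₂ hgal inv ℓ hℓ (hN ℓ hℓ) hc ?_
    -- `loc_ℓ κ_k(Q)` is a local Kummer class, hence dies in `H¹(ℚ_ℓ, W[p^∞])` (`ℓ ∤ p`)
    have hxS : galoisCohomology.localization ρ (Sum.inr ℓ) 1 x ∈ W.kummerSelmerStructure ((p ^ k : ℕ) : ℤ) (Sum.inr ℓ) :=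
      (W.mem_selmerGroup_iff_forall_localization_mem ((p ^ k : ℕ) : ℤ) x).mp
        (W.kummerMapTorsion_mem_selmerGroup ((p ^ k : ℕ) : ℤ) hdiv Q) (Sum.inr ℓ)
    rw [WeierstrassCurve.kummerSelmerStructure_apply] at hxS
    change _ ∈ W.kummerLocalConditionAt ((p ^ k : ℕ) : ℤ) (ℓ.adicCompletion ℚ) at hxS
    rw [kummerLocalConditionAt_eq_ker_map_primaryInclusion W p k ℓ (natCast_not_mem_of_ne_primePlace p hℓ) hn,
      AddMonoidHom.mem_ker] at hxS
    rw [hxS]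
    exact zero_mem _

end Orthogonal

/-! ## §2 `ZetaLineOrthIndexAt` forces `W(ℚ)` finite (Kato Thm. 14.5, GZK-free) -/

section RankZero

variable (W : WeierstrassCurve ℚ) [W.IsElliptic] (p : ℕ) [hp : Fact p.Prime] [ContinuousSMul ℤ_[p] (W.tateModule p)]

/-- **A class whose zeta line has a local index at `p` forces `W(ℚ)` to be FINITE** (Kato Thm. 14.5 / Cor. 14.3 for the pinned class, WITHOUT
Gross–Zagier–Kolyvagin): `y₀ ∈ A = H¹(ℤ[1/p], T_pW)` with `ZetaLineOrthIndexAt W p y₀ e`, `p` odd, and the Poitou–Tate fact over `ℚ` (a tree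
theorem; one family per level instantiates the predicate, with the PROVED Weil data).  If `P ∈ W(ℚ)` had infinite order, §1 makes `f_k(y₀)`
orthogonal to `κ(ℤ·P) ⊆ 𝓚_{k,p}`, the log lattice (`…PadicPointsApproximation`) gives ONE `M ≠ 0` with `M·𝓚_{k,p} ⊆ κ(ℤ·P)` modulo
`p^k`, so `f_k(M·y₀) ⊥ 𝓚_{k,p}` and the predicate yields `p^k ∣ M·p^e` for all large `k`.  Hence `W(ℚ)` is torsion, and finite by
Mordell–Weil (tree theorem `module_finite_point_holds`). [cite: Kato2004Asterisque, Thm. 14.2, Cor. 14.3 and Thm. 14.5 (pp. 235–236), Prop. 14.16 (2) (p. 244)]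
[cite: MilneADT2006, Ch. I, Cor. 2.3, Thm. 4.10 (b)] [cite: SilvermanAEC2009, VII.6.3, VIII.6.7, X.§4] -/
theorem finite_point_of_zetaLineOrthIndexAt (hPT : poitouTate_selmerStructure_duality ℚ) (hodd : p ≠ 2)
    {y₀ : H1 (tateRep W p) ⊤} (hy₀ : y₀ ∈ integralH1 (tateRep W p) p ⊤) {e : ℕ} (h : ZetaLineOrthIndexAt W p y₀ e) :
    Finite W.toAffine.Point := by
  have hpp : p.Prime := hp.out
  -- Mordell–Weil: it suffices that every rational point has finite order
  suffices htors : ∀ P : W.toAffine.Point, IsOfFinAddOrder P by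
    -- (the tree's Mordell–Weil theorem is stated with the classical `DecidableEq ℚ`; `convert` bridges the instance)
    letI instC : AddCommGroup W.toAffine.Point :=
      @Affine.Point.instAddCommGroup ℚ _ W.toAffine (fun a b => Classical.propDecidable (a = b))
    haveI hMW : Module.Finite ℤ W.toAffine.Point := W.module_finite_point_holds
    exact Module.finite_of_fg_torsion W.toAffine.Point
      ((AddMonoid.isTorsion_iff_isTorsion_int).mp fun P => by convert htors P)
  intro P
  by_contra hP
  -- the local point at `v_p` and the approximation constant `M`
  set Pv : (W.baseChange ((primePlace p).adicCompletion ℚ)).toAffine.Point :=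
    Affine.Point.baseChange (W' := W) ℚ ((primePlace p).adicCompletion ℚ) P with hPv
  have hPv' : ¬ IsOfFinAddOrder Pv := PadicPointsApproximation.not_isOfFinAddOrder_map
    (Affine.Point.baseChange (W' := W) ℚ ((primePlace p).adicCompletion ℚ))
    (Affine.Point.map_injective (W' := W) (Algebra.ofId ℚ ((primePlace p).adicCompletion ℚ))) hP
  obtain ⟨M, hM0, hM⟩ := PadicPointsApproximation.exists_mul_smul_eq_zsmul_add_pow_smul_adicCompletion p W Pv hPv'
  -- the finite set of bad places and g17's (hN)-bound off `p`
  obtain ⟨S, hS⟩ : ∃ S : Finset (HeightOneSpectrum (𝓞 ℚ)), ∀ v, v ∉ S → W.HasGoodReductionAt v := by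
    have hev := WeierstrassCurve.eventually_hasGoodReductionAt W
    rw [Filter.eventually_cofinite] at hev
    exact ⟨hev.toFinset, fun v hv => by_contra fun hbad => hv (hev.mem_toFinset.mpr hbad)⟩
  obtain ⟨j, hj⟩ := exists_forall_hN W p {primePlace p} (insert (primePlace p) S) (fun v hv =>
    ⟨natCast_not_mem_of_ne_primePlace p (fun h' => hv (h' ▸ Finset.mem_insert_self _ _)),
      hS v (fun h' => hv (Finset.mem_insert_of_mem h'))⟩)
  -- the level: `k ≥ k₁` with `p^k > M·p^e`
  obtain ⟨k₁, hk⟩ := h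
  obtain ⟨k, hk₁, hbig⟩ : ∃ k : ℕ, k₁ ≤ k ∧ M * p ^ e < p ^ k := by
    refine ⟨k₁ + M * p ^ e, by omega, ?_⟩
    calc M * p ^ e < 2 ^ (M * p ^ e) := Nat.lt_two_pow_self
      _ ≤ p ^ (M * p ^ e) := Nat.pow_le_pow_left hpp.two_le _
      _ ≤ p ^ (k₁ + M * p ^ e) := Nat.pow_le_pow_right hpp.pos (by omega)
  haveI := neZero_pow p j; haveI := neZero_pow p k
  haveI : Finite (geomTorsion W ((p ^ k : ℕ) : ℤ)) := finite_geomTorsion_pow W p k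
  haveI : Finite (geomTorsion W ((p ^ j * p ^ k : ℕ) : ℤ)) :=
    W.finite_torsionPoints_holds (AlgebraicClosure ℚ) (Int.natCast_ne_zero.mpr (NeZero.ne (p ^ j * p ^ k)))
  have hk1 : k ≠ 0 := by
    rintro rfl
    have : 1 ≤ M * p ^ e := Nat.mul_pos (Nat.pos_of_ne_zero hM0) (pow_pos hpp.pos e)
    rw [pow_zero] at hbig
    omega
  have hpk2 : 2 ≤ p ^ k := le_trans hpp.two_le (Nat.le_self_pow hk1 p)
  -- one Poitou–Tate family and one Weil datum at level `p^j p^k`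
  obtain ⟨inv, hperf, hsum, -, -⟩ := hPT (p ^ j * p ^ k)
  obtain ⟨ε, hμ, hadd₁, hadd₂, halt, hnondeg, hgal⟩ := (W.exists_weilPairing_holds (p ^ j * p ^ k))
    (le_trans hpk2 (Nat.le_mul_of_pos_left _ (pow_pos hpp.pos j))) (Nat.cast_ne_zero.mpr (NeZero.ne (p ^ j * p ^ k)))
  have hn : ((p ^ k : ℕ) : ℤ) ≠ 0 := Int.natCast_ne_zero.mpr (NeZero.ne (p ^ k))
  have hdivk : ∀ R : geomPoints W, ∃ R' : geomPoints W, ((p ^ k : ℕ) : ℤ) • R' = R :=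
    W.zsmul_geomPoints_surjective_holds hn
  -- the composite `f_k` as ONE additive map
  let F : H1 (tateRep W p) ⊤ →+
      galoisCohomology (((W.torsionGaloisModule ((p ^ k : ℕ) : ℤ)).tateDual (p ^ j * p ^ k)).toLocal (Sum.inr (primePlace p))) 1 :=
    ((galoisCohomology.localization ((W.torsionGaloisModule ((p ^ k : ℕ) : ℤ)).tateDual (p ^ j * p ^ k))
        (Sum.inr (primePlace p)) 1).comp
      (galoisCohomology.map (pairingDualIntertwining
        (ρ₁ := W.torsionGaloisModule ((p ^ k : ℕ) : ℤ)) (ρ₂ := W.torsionGaloisModule ((p ^ k : ℕ) : ℤ))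
        (B := descendHom W (p ^ j) (p ^ k) ε hμ hadd₁ hadd₂)
        (descendHom_smul W (p ^ j) (p ^ k) ε hμ hadd₁ hadd₂ hgal)) 1)).comp
      (((galoisCohomology.map (W.torsionInclusion
          (show ((p : ℤ) ^ k) ∣ ((p ^ k : ℕ) : ℤ) from ⟨1, (Nat.cast_pow p k).trans (mul_one _).symm⟩)) 1).comp
        (ofTopSubgroup (W.torsionGaloisModule ((p : ℤ) ^ k)).toTopRep 1).hom.toLinearMap.toAddMonoidHom).comp (reduceH1Pk W p k ⊤))
  set L := localTatePairingZMod (W.torsionGaloisModule ((p ^ k : ℕ) : ℤ)) (p ^ j * p ^ k) (Sum.inr (primePlace p))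
    (inv (Sum.inr (primePlace p))) with hL
  set κv := W.localKummerMap ((primePlace p).adicCompletion ℚ) hn with hκv
  -- the local Kummer condition is the range of `κv` (`CharZero ℚ_v` passed EXPLICITLY: as a local instance it would let
  -- `DivisionRing.toRatAlgebra` pre-empt the completion's `ℚ`-algebra structure, cf. `KatoDescentLocPKummerLogExistence`)
  have hrange : κv.range = W.kummerLocalConditionAt ((p ^ k : ℕ) : ℤ) ((primePlace p).adicCompletion ℚ) :=
    @WeierstrassCurve.range_localKummerMap ℚ _ W _ _ _ _ _ _ (charZero_adicCompletion _) hn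
  -- §1 at the rational point `P`
  have h0 : L (galoisCohomology.localization (W.torsionGaloisModule ((p ^ k : ℕ) : ℤ)) (Sum.inr (primePlace p)) 1
      (kummerMapTorsion W ((p ^ k : ℕ) : ℤ) hdivk P)) (F y₀) = 0 :=
    localTatePairingZMod_localization_kummerMapTorsion_descend_reduceH1Pk_eq_zero W p j k ε hμ hadd₁ hadd₂ hgal inv hodd hsum
      (fun v hv => hj j le_rfl k v (fun h' => hv (Finset.mem_singleton.mp h'))) hy₀ hdivk P
  -- `κ(P_v) = loc_p κ_k(P)`
  have hloc : κv Pv = galoisCohomology.localization (W.torsionGaloisModule ((p ^ k : ℕ) : ℤ)) (Sum.inr (primePlace p)) 1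
      (kummerMapTorsion W ((p ^ k : ℕ) : ℤ) hdivk P) :=
    (Rank1Residual.X11b.KummerIndex.res_kummerMapTorsion_eq_localKummerMap W ((primePlace p).adicCompletion ℚ) hn hdivk P).symm
  -- the predicate at `c = M`: `f_k(M·y₀)` is orthogonal to every local Kummer class
  have hdvd : ((p ^ k : ℕ) : ℤ) ∣ (M : ℤ) * p ^ e :=
    hk k hk₁ j inv hsum hperf ε hμ hadd₁ hadd₂ hgal halt hnondeg (M : ℤ) (fun x hx => by
      change L x (F ((M : ℤ) • y₀)) = 0
      have hx' : x ∈ κv.range := by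
        rw [hrange]; rw [WeierstrassCurve.kummerSelmerStructure_apply] at hx; exact hx
      obtain ⟨x', rfl⟩ := hx'
      obtain ⟨n, y', hy'⟩ := hM k x'
      -- `⟨κ x', F(M y₀)⟩ = ⟨κ(M x'), F y₀⟩`
      have h1 : L (κv x') (F ((M : ℤ) • y₀)) = L (κv ((M : ℤ) • x')) (F y₀) := by
        rw [map_zsmul F, map_zsmul (L (κv x')), map_zsmul κv]
        have e2 := map_zsmul (L.flip (F y₀)) (M : ℤ) (κv x')
        exact e2.symm
      have hκ0 : κv (((p ^ k : ℕ) : ℤ) • y') = 0 := by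
        rw [map_zsmul, natCast_zsmul]
        exact Rank1Residual.X11b.KummerPT.nsmul_galoisCohomology_toLocal_eq_zero W (p ^ k) (Sum.inr (primePlace p)) _
      rw [h1, hy', map_add κv, hκ0, add_zero, map_zsmul κv, hloc]
      have e3 := map_zsmul (L.flip (F y₀)) n (galoisCohomology.localization (W.torsionGaloisModule ((p ^ k : ℕ) : ℤ))
        (Sum.inr (primePlace p)) 1 (kummerMapTorsion W ((p ^ k : ℕ) : ℤ) hdivk P))
      have h0' : (L.flip (F y₀)) (galoisCohomology.localization (W.torsionGaloisModule ((p ^ k : ℕ) : ℤ))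
        (Sum.inr (primePlace p)) 1 (kummerMapTorsion W ((p ^ k : ℕ) : ℤ) hdivk P)) = 0 := h0
      rw [h0', smul_zero] at e3
      exact e3)
  -- contradiction: `p^k ∣ M·p^e < p^k`
  have hdvd' : p ^ k ∣ M * p ^ e := by exact_mod_cast hdvd
  exact absurd (Nat.le_of_dvd (Nat.mul_pos (Nat.pos_of_ne_zero hM0) (pow_pos hpp.pos e)) hdvd') (not_le.mpr hbig)

end RankZero

/-! ## §3 On the core package: `W(ℚ)` finite; the zeta package and crux M's node WITHOUT Gross–Zagier–Kolyvagin -/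

section Core

variable {W : WeierstrassCurve ℚ} [W.IsElliptic] {p : ℕ} [Fact p.Prime] [ContinuousSMul ℤ_[p] (W.tateModule p)]
  {κ : ZpExtension ℚ p} {γ : absoluteGaloisGroup ℚ} {I : IwasawaH1Data W p κ γ} {y : I.H}

/-- **On a core package, `W(ℚ)` is finite** (clause (b′) `zetaLineIndex` + §2; `p` odd; one Poitou–Tate family to instantiate the
predicate) — Kato Cor. 14.3 / Thm. 14.5 for the member, Euler-system side, no Gross–Zagier–Kolyvagin.
[cite: Kato2004Asterisque, Cor. 14.3 and Thm. 14.5 (pp. 235–236), Prop. 14.16 (2) (p. 244), Lemma 14.18 (pp. 247–248)] -/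
theorem _root_.Literature.NumberTheory.EllipticCurves.Kato2004.MemberHullZetaCoreInputs.finite_point_of_PT
    (Z : MemberHullZetaCoreInputs W p κ γ I y) (hPT : poitouTate_selmerStructure_duality ℚ) (hodd : p ≠ 2) :
    Finite W.toAffine.Point := by
  obtain ⟨q, -, e, -, hZL⟩ := Z.zetaLineIndex
  exact finite_point_of_zetaLineOrthIndexAt W p hPT hodd (layerZeroToTop_mem_integralH1 W p κ (I.proj_mem 0 y)) hZL

/-- **The core package gives the zeta package on every pin with `Ш(W)[p^∞]` finite — NO `W(ℚ)`-finiteness hypothesis** (it is a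
theorem of the package, `finite_point_of_PT`); `p` odd, `κ` cyclotomic, `γ` a generator, Poitou–Tate fact.
[cite: Kato2004Asterisque, Thm. 14.5 (pp. 235–236), Prop. 14.16 (2) (p. 244)] -/
theorem _root_.Literature.NumberTheory.EllipticCurves.Kato2004.MemberHullZetaCoreInputs.nonempty_memberHullZetaInputs'
    (Z : MemberHullZetaCoreInputs W p κ γ I y) (hκ : κ.IsCyclotomic) (hγ : κ.IsTopGenerator γ)
    (hPT : poitouTate_selmerStructure_duality ℚ) (hodd : p ≠ 2) [Finite (AddCommGroup.primaryComponent W.sha p)] :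
    Nonempty (MemberHullZetaInputs W p κ γ I y) := by
  haveI : Finite W.toAffine.Point := Z.finite_point_of_PT hPT hodd
  exact Z.nonempty_memberHullZetaInputs hκ hγ hPT hodd

end Core

section Facts

/-- **`exists_memberHullZetaCoreInputs → exists_memberHullZetaInputs` given ONLY the Poitou–Tate fact — NO Gross–Zagier–Kolyvagin**
(compare seat g21's `exists_memberHullZetaInputs_of_coreInputs`, which took `rank_eq_analyticRank_of_analyticRank_le_one` for the
finiteness of `W_K(ℚ)`; here that finiteness is `finite_point_of_PT`, from clause (b′) of the package itself).
[cite: Kato2004Asterisque, Cor. 14.3, Thm. 14.5 (pp. 235–236), Prop. 14.16 (2) (pp. 244–245), Lemma 14.18 (pp. 247–248), (14.14.2) (p. 243)]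
[cite: MilneADT2006, Ch. I, Thm. 4.10 (b)] -/
theorem exists_memberHullZetaInputs_of_coreInputs_noGZK (hPT : poitouTate_selmerStructure_duality ℚ)
    (h : exists_memberHullZetaCoreInputs) : exists_memberHullZetaInputs := by
  intro W _ _ p _ hp hgood hmult hj hirr hL hsha
  obtain ⟨W', hW'e, hW'm, hiso, hrest⟩ := h W p hp hgood hmult hj hirr hL hsha
  haveI := hW'e
  have hshaW' : W'.ShaFinite := hiso.shaFinite_iff_shaFinite.mp hsha
  haveI : Finite W'.sha := hshaW'
  refine ⟨W', hW'e, hW'm, hiso, ?_⟩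
  intro _ _ _ N _ f hf ι
  obtain ⟨κ', Λ', c, d, a, A, z, x, hκ', hA, hc, hd, hZB, hall⟩ := hrest f hf ι
  refine ⟨κ', Λ', c, d, a, A, z, x, hκ', hA, hc, hd, hZB, ?_⟩
  intro κ γ hκ hγ I y hy
  obtain ⟨Z⟩ := hall κ γ hκ hγ I y hy
  exact Z.nonempty_memberHullZetaInputs' hκ hγ hPT hp

/-- **`exists_memberHullZetaCoreInputs → exists_memberHullZetaInputs`, UNCONDITIONALLY** (the Poitou–Tate fact over `ℚ` is a tree
theorem: `InputsPoitouTateSelmer.poitouTate_selmerStructure_duality_conj_holds ℚ` + `poitouTate_selmerStructure_duality_of_conj`).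
[cite: Kato2004Asterisque, Cor. 14.3, Thm. 14.5 (pp. 235–236), Prop. 14.16 (2) (pp. 244–245)] [cite: MilneADT2006, Ch. I, Thm. 4.10 (b)] -/
theorem exists_memberHullZetaInputs_of_coreInputs' (h : exists_memberHullZetaCoreInputs) : exists_memberHullZetaInputs :=
  exists_memberHullZetaInputs_of_coreInputs_noGZK
    (poitouTate_selmerStructure_duality_of_conj (InputsPoitouTateSelmer.poitouTate_selmerStructure_duality_conj_holds ℚ)) h

/-- **`exists_memberHullZetaKummerCoreInputs → exists_memberHullZetaInputs`, UNCONDITIONALLY** (the print-exact Kummer-form package,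
through the kernel bridge Kummer ⇒ pairing form, then the previous theorem).
[cite: Kato2004Asterisque, Prop. 14.16 (2) (p. 244) and Lemma 14.18 (pp. 247–248)] [cite: MilneADT2006, Ch. I, Cor. 3.4 and Thm. 4.10 (b)] -/
theorem exists_memberHullZetaInputs_of_kummerCoreInputs' (h : exists_memberHullZetaKummerCoreInputs) :
    exists_memberHullZetaInputs :=
  exists_memberHullZetaInputs_of_coreInputs' (MemberHullZetaCoreInputsOfKummer.exists_memberHullZetaCoreInputs_of_kummerCoreInputs h)

/-- **`exists_memberHullZetaCoreInputs → exists_memberHullInputs`, UNCONDITIONALLY** (then seat g13's GZK-free descent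
`exists_memberHullZetaInputs → exists_memberHullInputs`). [cite: Kato2004Asterisque, Thm. 12.5 (3) (p. 222), Thm. 14.5 (pp. 235–236)] -/
theorem exists_memberHullInputs_of_coreInputs' (h : exists_memberHullZetaCoreInputs) : exists_memberHullInputs :=
  ZetaInputsDescent.exists_memberHullInputs_of_zetaInputs' (exists_memberHullZetaInputs_of_coreInputs' h)

/-- **THE O6 NODE BEHIND CRUX M FROM MODULARITY AND KATO'S CORE MEMBER PACKAGE ALONE** — `Rank1Residual.O6.KatoMemberShaBoundOfReducible`
from `exists_isNewformOf` and `exists_memberHullZetaCoreInputs`; NO Gross–Zagier–Kolyvagin, NO Poitou–Tate hypothesis (both were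
binders of seat g23's `CoreInputsNoPT.katoMemberShaBoundOfReducible_of_newform_of_gzk_of_coreInputs`).  Composition with seat g13's
route-free descent `ZetaInputsDescent.katoMemberShaBoundOfReducible_of_newform_of_zetaInputs`.
[cite: Kato2004Asterisque, Thm. 12.5/12.6 (p. 222), Lemma 13.10 (1) (p. 230), Cor. 14.3 / Thm. 14.5 (pp. 235–236), (14.14.1)–(14.14.2) (p. 243), Prop. 14.16 (2) (pp. 244–245)]
[cite: Kim2022StructureSelmer, §3.2.3] -/
theorem katoMemberShaBoundOfReducible_of_newform_of_coreInputs (hmod : exists_isNewformOf)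
    (hC : exists_memberHullZetaCoreInputs) : Rank1Residual.O6.KatoMemberShaBoundOfReducible :=
  ZetaInputsDescent.katoMemberShaBoundOfReducible_of_newform_of_zetaInputs hmod (exists_memberHullZetaInputs_of_coreInputs' hC)

/-- **The same node from modularity and the PRINT-EXACT Kummer-form package** `exists_memberHullZetaKummerCoreInputs` (p637289).
[cite: Kato2004Asterisque, Prop. 14.16 (2) (p. 244), Lemma 14.18 (pp. 247–248)] [cite: Kim2022StructureSelmer, §3.2.3] -/
theorem katoMemberShaBoundOfReducible_of_newform_of_kummerCoreInputs (hmod : exists_isNewformOf)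
    (hK : exists_memberHullZetaKummerCoreInputs) : Rank1Residual.O6.KatoMemberShaBoundOfReducible :=
  katoMemberShaBoundOfReducible_of_newform_of_coreInputs hmod
    (MemberHullZetaCoreInputsOfKummer.exists_memberHullZetaCoreInputs_of_kummerCoreInputs hK)

end Facts

end Summit.BirchSwinnertonDyer.BirchSwinnertonDyer.Theorems.ZetaLineRankZero

end
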